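import Mathlib
import Summits.CriticalPhenomena.PercolationContinuityZ3.Theorems.PercNearOneGluingNoHeavyLowerTailMarkovFirstEdge
import HarnessLib

/-!
# `NoHeavyLowerTail` (stmt-CriticalPhenomena-4575) — SPIDERS via the Markov first-edge bound: a cumulative-isolation
# bound uniform in the number of legs AND in their lengths (for individually reliable legs), lightness in `G`

Seat `prim-cplus-engine` gen 7, 2026-08-19 (`--supports stmt-CriticalPhenomena-4575`).  No definitions, no named facts,
no sorries.  Sequel of `…MarkovFirstEdge.lean` (`MarkovFirstEdge.lowerTail_le_markov_firstEdge`) and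
`…ObserverUnionBoundG.lean` (spider hypothesis, `G ∖ e` tools).

A SPIDER: observer `o ∉ A` every non-relay neighbour `x` of which starts an injective Steiner path `p` (`p 0 = x`,
all `p i ∉ A`) whose vertices have, besides relays (hairs, arbitrary), no positive-weight non-relay neighbour other
than their path neighbours and — for `p 0` only — `o`; legs of any length, `o` may carry direct relay pairs, the relay
side is arbitrary (hypothesis `hlegs`, verbatim as in `ObserverUnionBoundG.spider_lowerTail_le_pinW`).

* `spider_term_le` — per neighbour `x ≠ o` (all pairs at `o` of weight `≤ 1/2`, `μ_w(|π(a)| ≤ j) ≤ M` on `A`):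
  `α_x · μ_{G∖s(o,x)}(1 ≤ N_x ≤ j) ≤ 2 w(o,x) · 2M` (`α_x = −log(1 − w(o,x)) ≤ 2 w(o,x)`; `cil_steinerPath` in
  `G ∖ s(o,x)`; one closed pair costs the factor `2`).
* `spider_lowerTail_le_markov` — for every `λ > 0`:
      `μ_w(1 ≤ N_o ≤ j) ≤ e^{2λ}·μ_w(o ↮ A) + e^{−λ} + (4M/λ)·Σ_{x ≠ o} w(o,x)`.

READING (LEAD-GEN6 §8, Q7 "(r, L)-uniform spiders").  If every leg is attached to `A` off `o` with probability `≥ v`,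
then `δ₀ = μ(o ↮ A) = ∏_x (1 − w(o,x) v_x) ≤ exp(−v Σ_x w(o,x))`, so `λ := log(1/δ₀)/3 ≥ (v/3) Σ_x w(o,x)` gives
      `μ_w(1 ≤ N_o ≤ j) ≤ 2 δ₀^{1/3} + (12/v)·M`,
uniform in the number `r` of legs and in their lengths `L`, `G`-form (`M = max_a μ_w(|π(a)| ≤ j)`, e.g. `≤ 2t` at
`j = |A|/2` by pair counting).  The tree's earlier spider bounds have constant `deg_w(o)` (`SpiderCIL`, reference
`G − o`; `ObserverUnionBoundG`, reference `G`).  The regime NOT covered uniformly is that of many individually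
unreliable legs (each attached with probability `≪ 1`), where `Σ_x w(o,x) ≫ log(1/δ₀)`; there one needs the leg
defect to be proportional to the leg's attachment probability ("conditional CIL for Steiner paths"), which is not in
the tree.
-/

namespace Summit.CriticalPhenomena.PercolationContinuityZ3.Theorems

open MeasureTheory Set
open Literature.Probability.LatticeModels (prodBernoulli)
open Literature.Probability.Percolation

noncomputable section
open Classical

variable {n : ℕ}

namespace MarkovFirstEdge

/-! ### Spiders: the `(r, L)`-uniform form -/

/-- Per-neighbour estimate for spiders with `G`-form lightness: for `x ≠ o` with all pairs at `o` of weight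
`≤ 1/2` and `μ_w(|π(a)| ≤ j) ≤ M` on `A`,
`α_x · μ_{G∖s(o,x)}(1 ≤ N_x ≤ j) ≤ 2 w(o,x) · 2M` (`α_x ≤ 2 w(o,x)`; relays: drop `1 ≤ ·`; leg starts:
`cil_steinerPath` in `G ∖ s(o,x)`; one closed pair costs the factor `2`). [this work] -/
theorem spider_term_le (w : Sym2 (Fin n) → unitInterval) (A : Finset (Fin n)) (o : Fin n) (j : ℕ) (M : ℝ)
    (hM : 0 ≤ M) (hhalf : ∀ x : Fin n, x ≠ o → (w s(o, x) : ℝ) ≤ 1 / 2)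
    (hlightG : ∀ a ∈ A, (prodBernoulli w).real
      {ω : BondConfig (Fin n) | (A.filter fun z => ω ∈ openConn a z).card ≤ j} ≤ M)
    (hlegs : ∀ x : Fin n, x ≠ o → x ∉ A → w s(o, x) ≠ 0 →
      ∃ (k : ℕ) (p : Fin (k + 1) → Fin n), Function.Injective p ∧ p 0 = x ∧ (∀ i, p i ∉ A) ∧
        (∀ (i : Fin (k + 1)) (v : Fin n), v ∉ A → v ≠ p i → 0 < (w s(p i, v) : ℝ) →
          (v = o ∧ i = 0) ∨ ∃ l : Fin (k + 1), v = p l ∧ (l.val = i.val + 1 ∨ i.val = l.val + 1)))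
    {x : Fin n} (hxo : x ≠ o) :
    (-Real.log (1 - (w s(o, x) : ℝ))) *
        (prodBernoulli (pinW w ({s(o, x)} : Set (Sym2 (Fin n))) ∅)).real
          {ω : BondConfig (Fin n) | 1 ≤ (A.filter fun a => ω ∈ openConn x a).card ∧
            (A.filter fun a => ω ∈ openConn x a).card ≤ j} ≤
      2 * (w s(o, x) : ℝ) * (2 * M) := by
  set wx := pinW w ({s(o, x)} : Set (Sym2 (Fin n))) ∅ with hwx
  have hw0 : 0 ≤ (w s(o, x) : ℝ) := (w s(o, x)).2.1
  have hα : -Real.log (1 - (w s(o, x) : ℝ)) ≤ 2 * (w s(o, x) : ℝ) := by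
    -- `-log(1-t) ≤ (1-t)⁻¹ - 1 ≤ 2t` for `0 ≤ t ≤ 1/2`
    have hpos : 0 < 1 - (w s(o, x) : ℝ) := by linarith [hhalf x hxo]
    have hlog := Real.log_le_sub_one_of_pos (inv_pos.2 hpos)
    rw [Real.log_inv] at hlog
    have hinv : (1 - (w s(o, x) : ℝ))⁻¹ - 1 ≤ 2 * (w s(o, x) : ℝ) := by
      rw [inv_eq_one_div, div_sub_one hpos.ne', div_le_iff₀ hpos]
      nlinarith [hhalf x hxo]
    linarith
  have hαnn : 0 ≤ -Real.log (1 - (w s(o, x) : ℝ)) := by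
    have := Real.log_nonpos (by linarith [hhalf x hxo] : (0 : ℝ) ≤ 1 - w s(o, x)) (by linarith)
    linarith
  -- lightness in `G ∖ s(o,x)` is at most twice the lightness in `G`
  have hlight2 : ∀ a ∈ A, (prodBernoulli wx).real
      {ω : BondConfig (Fin n) | (A.filter fun z => ω ∈ openConn a z).card ≤ j} ≤ 2 * M := by
    intro a ha
    have h := ObserverUnionBoundG.pinW_single_real_mul_le w
      {ω : BondConfig (Fin n) | (A.filter fun z => ω ∈ openConn a z).card ≤ j} s(o, x)
    have hw := hhalf x hxo
    have hnn : 0 ≤ (prodBernoulli wx).real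
        {ω : BondConfig (Fin n) | (A.filter fun z => ω ∈ openConn a z).card ≤ j} := measureReal_nonneg
    nlinarith [hlightG a ha]
  -- the `G ∖ s(o,x)` lower tail of `x` is at most `2M`
  have hbad : (prodBernoulli wx).real
      {ω : BondConfig (Fin n) | 1 ≤ (A.filter fun a => ω ∈ openConn x a).card ∧
        (A.filter fun a => ω ∈ openConn x a).card ≤ j} ≤ 2 * M ∨ w s(o, x) = 0 := by
    by_cases hw : w s(o, x) = 0
    · exact Or.inr hw
    left
    by_cases hxA : x ∈ A
    · exact (measureReal_mono (fun ω hω => hω.2) (measure_ne_top _ _)).trans (hlight2 x hxA)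
    by_cases hA : A.Nonempty
    · obtain ⟨c, hc, hcmax⟩ := MergeStability.exists_champion (prodBernoulli wx) A hA j
      obtain ⟨k, p, hpinj, hp0, hpA, hpath⟩ := hlegs x hxo hxA hw
      have key := cil_steinerPath A j k wx p hpinj hpA (ObserverUnionBoundG.legs_pinW_of_legs w A o hp0 hpath) c hc hcmax
      rw [hp0] at key
      exact key.trans (hlight2 c hc)
    · rw [Finset.not_nonempty_iff_eq_empty] at hA
      have hempty : {ω : BondConfig (Fin n) | 1 ≤ (A.filter fun a => ω ∈ openConn x a).card ∧
          (A.filter fun a => ω ∈ openConn x a).card ≤ j} = ∅ := by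
        ext ω
        simp only [hA, Finset.filter_empty, Finset.card_empty, mem_setOf_eq, mem_empty_iff_false, iff_false,
          not_and, not_le]
        intro h
        exact absurd h (by norm_num)
      rw [hempty, measureReal_empty]
      positivity
  rcases hbad with hle | hw
  · exact mul_le_mul hα hle measureReal_nonneg (by positivity)
  · have h0 : (w s(o, x) : ℝ) = 0 := by rw [hw]; rfl
    rw [h0, sub_zero, Real.log_one, neg_zero, zero_mul, mul_zero, zero_mul]

/-- **Spiders, Markov form** (`(r, L)`-uniform reading in the module docstring).  `o ∉ A`; spider hypothesis `hlegs`
(as in `ObserverUnionBoundG.spider_lowerTail_le_pinW`); all pairs at `o` of weight `≤ 1/2`; `0 ≤ M` with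
`μ_w(|π(a)| ≤ j) ≤ M` for `a ∈ A` (lightness IN `G`).  Then for every `λ > 0`:
`μ_w(1 ≤ N_o ≤ j) ≤ e^{2λ}·μ_w(o ↮ A) + e^{−λ} + (4M/λ)·Σ_{x ≠ o} w(o,x)`. [this work] -/
theorem spider_lowerTail_le_markov (w : Sym2 (Fin n) → unitInterval) (A : Finset (Fin n)) (o : Fin n)
    (ho : o ∉ A) (j : ℕ) (M : ℝ) (hM : 0 ≤ M)
    (hhalf : ∀ x : Fin n, x ≠ o → (w s(o, x) : ℝ) ≤ 1 / 2)
    (hlightG : ∀ a ∈ A, (prodBernoulli w).real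
      {ω : BondConfig (Fin n) | (A.filter fun z => ω ∈ openConn a z).card ≤ j} ≤ M)
    (hlegs : ∀ x : Fin n, x ≠ o → x ∉ A → w s(o, x) ≠ 0 →
      ∃ (k : ℕ) (p : Fin (k + 1) → Fin n), Function.Injective p ∧ p 0 = x ∧ (∀ i, p i ∉ A) ∧
        (∀ (i : Fin (k + 1)) (v : Fin n), v ∉ A → v ≠ p i → 0 < (w s(p i, v) : ℝ) →
          (v = o ∧ i = 0) ∨ ∃ l : Fin (k + 1), v = p l ∧ (l.val = i.val + 1 ∨ i.val = l.val + 1)))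
    (lam : ℝ) (hlam : 0 < lam) :
    (prodBernoulli w).real {ω : BondConfig (Fin n) |
        1 ≤ (A.filter fun a => ω ∈ openConn o a).card ∧ (A.filter fun a => ω ∈ openConn o a).card ≤ j} ≤
      Real.exp (2 * lam) * (prodBernoulli w).real (⋃ a ∈ A, (openConn o a : Set (BondConfig (Fin n))))ᶜ +
        Real.exp (-lam) +
        (4 * M / lam) * ∑ x ∈ (Finset.univ.filter fun x : Fin n => x ≠ o), (w s(o, x) : ℝ) := by
  have hw1 : ∀ x : Fin n, x ≠ o → (w s(o, x) : ℝ) < 1 := fun x hx => by linarith [hhalf x hx]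
  refine (lowerTail_le_markov_firstEdge w A o ho j hw1 lam hlam).trans ?_
  have hsum : ∑ x ∈ (Finset.univ.filter fun x : Fin n => x ≠ o),
      (-Real.log (1 - (w s(o, x) : ℝ))) *
        (prodBernoulli (pinW w ({s(o, x)} : Set (Sym2 (Fin n))) ∅)).real
          {ω : BondConfig (Fin n) | 1 ≤ (A.filter fun a => ω ∈ openConn x a).card ∧
            (A.filter fun a => ω ∈ openConn x a).card ≤ j} ≤
      ∑ x ∈ (Finset.univ.filter fun x : Fin n => x ≠ o), 2 * (w s(o, x) : ℝ) * (2 * M) :=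
    Finset.sum_le_sum fun x hx => spider_term_le w A o j M hM hhalf hlightG hlegs (Finset.mem_filter.1 hx).2
  have hrw : ∑ x ∈ (Finset.univ.filter fun x : Fin n => x ≠ o), 2 * (w s(o, x) : ℝ) * (2 * M) =
      (4 * M) * ∑ x ∈ (Finset.univ.filter fun x : Fin n => x ≠ o), (w s(o, x) : ℝ) := by
    rw [Finset.mul_sum]
    exact Finset.sum_congr rfl fun x _ => by ring
  have h3 : (1 / lam) * ∑ x ∈ (Finset.univ.filter fun x : Fin n => x ≠ o),
      (-Real.log (1 - (w s(o, x) : ℝ))) *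
        (prodBernoulli (pinW w ({s(o, x)} : Set (Sym2 (Fin n))) ∅)).real
          {ω : BondConfig (Fin n) | 1 ≤ (A.filter fun a => ω ∈ openConn x a).card ∧
            (A.filter fun a => ω ∈ openConn x a).card ≤ j} ≤
      (4 * M / lam) * ∑ x ∈ (Finset.univ.filter fun x : Fin n => x ≠ o), (w s(o, x) : ℝ) := by
    calc (1 / lam) * _ ≤ (1 / lam) * ((4 * M) * ∑ x ∈ (Finset.univ.filter fun x : Fin n => x ≠ o), (w s(o, x) : ℝ)) :=
          mul_le_mul_of_nonneg_left (hsum.trans hrw.le) (by positivity)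
      _ = (4 * M / lam) * ∑ x ∈ (Finset.univ.filter fun x : Fin n => x ≠ o), (w s(o, x) : ℝ) := by ring
  linarith


end MarkovFirstEdge

end

end Summit.CriticalPhenomena.PercolationContinuityZ3.Theorems
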